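import Mathlib

/-!
# Candidate proof of `stub_circuitCore` (line `valuation-kernel-sweep`, crux stmt-KontsevichZagierPeriods-3469)

drefute seat refuter-drefute-stmt-KontsevichZagierPeriods-3469-g2-0. The registered stub VERBATIM (`stub_circuitCore_proof`),
via an abstract circuit lemma (`circuit_abstract`: order the parameters `t j = a0 j / lam j` at which the coordinates vanish
along the line of representations `a0 + s • lam`; the positive-index cone hit is the strict minimiser of `t` over `lam > 0`,
the negative-index hit the strict maximiser over `lam < 0`, and both happen iff `max_{lam<0} t < min_{lam>0} t` and the
zero-`lam` coefficients are positive), Cramer's rule in row form (`Matrix.mulVec_cramer` on the transpose,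
`Matrix.cramer_transpose_apply`), the dependency `∑ (-1)^i D i • v i = 0` (Laplace expansion `Matrix.det_succ_column_zero` of a
5 × 5 matrix with a repeated column) and uniqueness of coordinates (`Matrix.vecMul_injective_iff_isUnit`).
-/

open Finset Matrix

namespace Summit.KontsevichZagierPeriods.HyperbolicBloch.FiveTerm.Drefute


/-- **Abstract circuit lemma.** `lam` = the signed dependency, `a0` = a base representation, `t j = a0 j / lam j`
the parameter at which coordinate `j` vanishes along the line of representations. If `lam` takes both signs and the
parameters of the non-degenerate indices are pairwise distinct (genericity), the signed count of the cones containing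
the point vanishes. [folklore] -/
theorem circuit_abstract (lam a0 : Fin 5 → ℝ)
    (hP : ∃ j, 0 < lam j) (hN : ∃ j, lam j < 0)
    (hgen : ∀ j l, j ≠ l → lam j ≠ 0 → lam l ≠ 0 → a0 l - a0 j / lam j * lam l ≠ 0) :
    ∑ j, Real.sign (lam j) *
      (if (∀ l, l ≠ j → 0 < a0 l - a0 j / lam j * lam l) then (1 : ℝ) else 0) = 0 := by
  classical
  set t : Fin 5 → ℝ := fun j => a0 j / lam j with ht
  set IC : Fin 5 → Prop := fun j => ∀ l, l ≠ j → 0 < a0 l - t j * lam l with hIC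
  change ∑ j, Real.sign (lam j) * (if IC j then (1 : ℝ) else 0) = 0
  set P : Finset (Fin 5) := Finset.univ.filter fun j => 0 < lam j with hPdef
  set N : Finset (Fin 5) := Finset.univ.filter fun j => lam j < 0 with hNdef
  have hPne : P.Nonempty := by
    obtain ⟨j, hj⟩ := hP
    exact ⟨j, by simp [hPdef, hj]⟩
  have hNne : N.Nonempty := by
    obtain ⟨j, hj⟩ := hN
    exact ⟨j, by simp [hNdef, hj]⟩
  -- `t l * lam l = a0 l` off the degenerate indices
  have htl : ∀ l, lam l ≠ 0 → t l * lam l = a0 l := fun l hl => by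
    simp only [ht]
    field_simp
  -- distinct parameters
  have hdist : ∀ j l, j ≠ l → lam j ≠ 0 → lam l ≠ 0 → t j ≠ t l := by
    intro j l hjl hj hl heq
    apply hgen j l hjl hj hl
    show a0 l - t j * lam l = 0
    rw [heq, htl l hl, sub_self]
  -- extremal indices
  obtain ⟨jm, hjmP, hjm⟩ := P.exists_min_image t hPne
  obtain ⟨kM, hkMN, hkM⟩ := N.exists_max_image t hNne
  have hjm_pos : 0 < lam jm := by simpa [hPdef] using hjmP
  have hkM_neg : lam kM < 0 := by simpa [hNdef] using hkMN
  -- the common condition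
  set C : Prop := t kM < t jm ∧ ∀ l, lam l = 0 → 0 < a0 l with hC
  -- key rewriting of the cone condition at a non-degenerate `l`
  have hposl : ∀ j l, 0 < lam l → (0 < a0 l - t j * lam l ↔ t j < t l) := by
    intro j l hl
    rw [sub_pos, ← htl l hl.ne', mul_lt_mul_iff_of_pos_right hl]
  have hnegl : ∀ j l, lam l < 0 → (0 < a0 l - t j * lam l ↔ t l < t j) := by
    intro j l hl
    rw [sub_pos, ← htl l hl.ne, mul_lt_mul_right_of_neg hl]
  -- Claim A: cones of positive indices
  have claimA : ∀ j ∈ P, (IC j ↔ (j = jm ∧ C)) := by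
    intro j hj
    have hjpos : 0 < lam j := by simpa [hPdef] using hj
    constructor
    · intro h
      have hmin : ∀ l ∈ P, l ≠ j → t j < t l := by
        intro l hl hlj
        have hlpos : 0 < lam l := by simpa [hPdef] using hl
        exact (hposl j l hlpos).1 (h l hlj)
      have hjjm : j = jm := by
        by_contra hne
        have h1 := hmin jm hjmP (Ne.symm hne)
        have h2 := hjm j hj
        linarith
      refine ⟨hjjm, ?_, ?_⟩
      · have hne : kM ≠ j := by
          intro h'; rw [h'] at hkM_neg; linarith
        have := (hnegl j kM hkM_neg).1 (h kM hne)
        rw [← hjjm]; exact this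
      · intro l hl
        have hne : l ≠ j := by
          intro h'; rw [h'] at hl; linarith
        have := h l hne
        simpa [hl] using this
    · rintro ⟨rfl, hCk, hZ⟩ l hl
      rcases lt_trichotomy (lam l) 0 with hneg | hzero | hpos
      · rw [hnegl j l hneg]
        have hlN : l ∈ N := by simp [hNdef, hneg]
        exact lt_of_le_of_lt (hkM l hlN) hCk
      · have := hZ l hzero
        simpa [hzero] using this
      · rw [hposl j l hpos]
        have hlP : l ∈ P := by simp [hPdef, hpos]
        exact lt_of_le_of_ne (hjm l hlP) (hdist j l (Ne.symm hl) hjpos.ne' hpos.ne')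
  -- Claim B: cones of negative indices
  have claimB : ∀ k ∈ N, (IC k ↔ (k = kM ∧ C)) := by
    intro k hk
    have hkneg : lam k < 0 := by simpa [hNdef] using hk
    constructor
    · intro h
      have hmax : ∀ l ∈ N, l ≠ k → t l < t k := by
        intro l hl hlk
        have hlneg : lam l < 0 := by simpa [hNdef] using hl
        exact (hnegl k l hlneg).1 (h l hlk)
      have hkkM : k = kM := by
        by_contra hne
        have h1 := hmax kM hkMN (Ne.symm hne)
        have h2 := hkM k hk
        linarith
      refine ⟨hkkM, ?_, ?_⟩
      · have hne : jm ≠ k := by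
          intro h'; rw [h'] at hjm_pos; linarith
        have := (hposl k jm hjm_pos).1 (h jm hne)
        rw [← hkkM]; exact this
      · intro l hl
        have hne : l ≠ k := by
          intro h'; rw [h'] at hl; linarith
        have := h l hne
        simpa [hl] using this
    · rintro ⟨rfl, hCk, hZ⟩ l hl
      rcases lt_trichotomy (lam l) 0 with hneg | hzero | hpos
      · rw [hnegl k l hneg]
        have hlN : l ∈ N := by simp [hNdef, hneg]
        exact lt_of_le_of_ne (hkM l hlN) (hdist l k hl hneg.ne hkneg.ne)
      · have := hZ l hzero
        simpa [hzero] using this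
      · rw [hposl k l hpos]
        have hlP : l ∈ P := by simp [hPdef, hpos]
        exact lt_of_lt_of_le hCk (hjm l hlP)
  -- the signed count: split by the sign of `lam j`
  have hterm : ∀ j, Real.sign (lam j) * (if IC j then (1 : ℝ) else 0) =
      (if 0 < lam j then (if IC j then (1 : ℝ) else 0) else 0) -
        (if lam j < 0 then (if IC j then (1 : ℝ) else 0) else 0) := by
    intro j
    rcases lt_trichotomy (lam j) 0 with hneg | hzero | hpos
    · by_cases hI : IC j <;> simp [hI, Real.sign_of_neg hneg, hneg, not_lt.mpr hneg.le]
    · simp [hzero, Real.sign_zero]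
    · by_cases hI : IC j <;> simp [hI, Real.sign_of_pos hpos, hpos, not_lt.mpr hpos.le]
  simp_rw [hterm]
  have eP : ∑ j, (if 0 < lam j then (if IC j then (1 : ℝ) else 0) else 0) =
      ∑ j ∈ P, (if IC j then (1 : ℝ) else 0) := by
    rw [hPdef, Finset.sum_filter]
  have eN : ∑ j, (if lam j < 0 then (if IC j then (1 : ℝ) else 0) else 0) =
      ∑ j ∈ N, (if IC j then (1 : ℝ) else 0) := by
    rw [hNdef, Finset.sum_filter]
  rw [Finset.sum_sub_distrib, eP, eN, Finset.sum_boole, Finset.sum_boole, sub_eq_zero]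
  have hPf : P.filter IC = P.filter (fun j => j = jm ∧ C) := Finset.filter_congr claimA
  have hNf : N.filter IC = N.filter (fun j => j = kM ∧ C) := Finset.filter_congr claimB
  rw [hPf, hNf]
  by_cases hc : C
  · have e1 : P.filter (fun j => j = jm ∧ C) = {jm} := by
      ext j
      simp only [Finset.mem_filter, Finset.mem_singleton]
      exact ⟨fun h => h.2.1, fun h => ⟨h ▸ hjmP, h, hc⟩⟩
    have e2 : N.filter (fun j => j = kM ∧ C) = {kM} := by
      ext j
      simp only [Finset.mem_filter, Finset.mem_singleton]
      exact ⟨fun h => h.2.1, fun h => ⟨h ▸ hkMN, h, hc⟩⟩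
    rw [e1, e2]
    simp
  · have e1 : P.filter (fun j => j = jm ∧ C) = ∅ := by
      ext j
      simp [hc]
    have e2 : N.filter (fun j => j = kM ∧ C) = ∅ := by
      ext j
      simp [hc]
    rw [e1, e2]


/-- **Circuit lemma, determinant form** — the registered stub `stub_circuitCore` verbatim. [folklore] -/
theorem stub_circuitCore_proof :
    ∀ (v : Fin 5 → Fin 4 → ℝ) (Q : Fin 4 → ℝ) (D : Fin 5 → ℝ) (E : Fin 5 → Fin 4 → ℝ),
      (∀ j, D j = (Matrix.of fun a b => v (j.succAbove a) b).det) →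
      (∀ j a, E j a = ((Matrix.of fun a' b => v (j.succAbove a') b).updateRow a Q).det) →
      (∃ j : Fin 5, 0 < (-1 : ℝ) ^ (j : ℕ) * D j) → (∃ j : Fin 5, (-1 : ℝ) ^ (j : ℕ) * D j < 0) →
      (∀ j a, D j ≠ 0 → D (j.succAbove a) ≠ 0 → E j a ≠ 0) →
      ∑ j : Fin 5, (-1 : ℝ) ^ (j : ℕ) * Real.sign (D j) * (if ∀ a, 0 < D j * E j a then (1 : ℝ) else 0) = 0 := by
  intro v Q D E hD hE H1 H2 H3
  classical
  -- the matrices of the four vectors other than `j`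
  set M : Fin 5 → Matrix (Fin 4) (Fin 4) ℝ := fun j => Matrix.of fun a b => v (j.succAbove a) b with hM
  have hD' : ∀ j, D j = (M j).det := hD
  have hE' : ∀ j a, E j a = ((M j).updateRow a Q).det := hE
  -- Cramer's rule in row form: `∑ a, E j a • v (succAbove j a) = D j • Q`
  have cramer : ∀ j b, ∑ a, E j a * v (j.succAbove a) b = D j * Q b := by
    intro j b
    have h := congrFun (Matrix.mulVec_cramer (M j)ᵀ Q) b
    rw [Matrix.mulVec_transpose, Matrix.det_transpose] at h
    simp only [Matrix.vecMul, dotProduct, Matrix.cramer_transpose_apply, Pi.smul_apply,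
      smul_eq_mul] at h
    rw [hD' j]
    rw [← h]
    refine Finset.sum_congr rfl fun a _ => ?_
    rw [hE' j a, hM]
    simp only [Matrix.of_apply]
  -- the linear dependency `∑ i, (-1)^i D i • v i = 0` (a 5 × 5 determinant with two equal columns)
  have dep : ∀ b, ∑ i : Fin 5, (-1 : ℝ) ^ (i : ℕ) * D i * v i b = 0 := by
    intro b
    let Nb : Matrix (Fin 5) (Fin 5) ℝ := Matrix.of fun i c => Fin.cases (v i b) (fun c' => v i c') c
    have h0 : Nb.det = 0 :=
      Matrix.det_zero_of_column_eq (M := Nb) (i := 0) (j := b.succ) (Fin.succ_ne_zero b).symm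
        (fun k => by simp [Nb])
    rw [Matrix.det_succ_column_zero] at h0
    have hsub : ∀ i, Nb.submatrix i.succAbove Fin.succ = M i := by
      intro i
      ext a c
      simp [Nb, hM, Matrix.submatrix_apply]
    have h1 : ∑ i : Fin 5, (-1 : ℝ) ^ (i : ℕ) * v i b * (M i).det = 0 := by
      simpa [hsub, Nb] using h0
    rw [← h1]
    refine Finset.sum_congr rfl fun i _ => ?_
    rw [hD' i]
    ring
  -- a base representation of `Q`, omitting an index `jp` with positive coefficient
  obtain ⟨jp, hjp⟩ := H1
  have hDjp : D jp ≠ 0 := by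
    intro h
    rw [h, mul_zero] at hjp
    exact lt_irrefl _ hjp
  set lam : Fin 5 → ℝ := fun j => (-1 : ℝ) ^ (j : ℕ) * D j with hlam
  set a0 : Fin 5 → ℝ := (Fin.insertNth jp (0 : ℝ) (fun a => E jp a / D jp) : Fin 5 → ℝ) with ha0
  have ha0j : a0 jp = 0 := by
    simp [ha0]
  have ha0s : ∀ a, a0 (jp.succAbove a) = E jp a / D jp := by
    intro a
    simp [ha0]
  have rep0 : ∀ b, ∑ l, a0 l * v l b = Q b := by
    intro b
    rw [Fin.sum_univ_succAbove _ jp, ha0j, zero_mul, zero_add]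
    simp_rw [ha0s]
    have hc := cramer jp b
    calc ∑ a, E jp a / D jp * v (jp.succAbove a) b
        = (∑ a, E jp a * v (jp.succAbove a) b) / D jp := by
          rw [Finset.sum_div]
          exact Finset.sum_congr rfl fun a _ => by ring
      _ = Q b := by
          rw [hc]
          field_simp
  have hlam_ne : ∀ j, lam j ≠ 0 ↔ D j ≠ 0 := by
    intro j
    simp only [hlam, ne_eq, mul_eq_zero, pow_eq_zero_iff', neg_eq_zero, one_ne_zero, false_and,
      false_or]
  -- coordinates of `Q` in the basis omitting `j` (for `D j ≠ 0`), along the line of representations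
  have coord : ∀ j, D j ≠ 0 → ∀ a,
      E j a / D j = a0 (j.succAbove a) - a0 j / lam j * lam (j.succAbove a) := by
    intro j hj
    have hlamj : lam j ≠ 0 := (hlam_ne j).2 hj
    have hunit : IsUnit (M j) := by
      rw [Matrix.isUnit_iff_isUnit_det, ← hD' j]
      exact isUnit_iff_ne_zero.mpr hj
    have hinj := Matrix.vecMul_injective_iff_isUnit.mpr hunit
    have e1 : Matrix.vecMul (fun a => E j a / D j) (M j) = Q := by
      ext b
      simp only [Matrix.vecMul, dotProduct, hM, Matrix.of_apply]
      rw [show ∑ a, E j a / D j * v (j.succAbove a) b = (∑ a, E j a * v (j.succAbove a) b) / D j from by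
        rw [Finset.sum_div]
        exact Finset.sum_congr rfl fun a _ => by ring]
      rw [cramer j b]
      field_simp
    have e2 : Matrix.vecMul (fun a => a0 (j.succAbove a) - a0 j / lam j * lam (j.succAbove a))
        (M j) = Q := by
      ext b
      simp only [Matrix.vecMul, dotProduct, hM, Matrix.of_apply]
      have hsplit := Fin.sum_univ_succAbove (fun l => (a0 l - a0 j / lam j * lam l) * v l b) j
      have hj0 : (a0 j - a0 j / lam j * lam j) * v j b = 0 := by
        rw [div_mul_cancel₀ _ hlamj, sub_self, zero_mul]
      rw [hj0, zero_add] at hsplit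
      rw [← hsplit]
      have hlin : ∑ l, (a0 l - a0 j / lam j * lam l) * v l b =
          ∑ l, a0 l * v l b - a0 j / lam j * ∑ l, lam l * v l b := by
        rw [Finset.mul_sum, ← Finset.sum_sub_distrib]
        exact Finset.sum_congr rfl fun l _ => by ring
      have hdep : ∑ l, lam l * v l b = 0 := dep b
      rw [hlin, rep0 b, hdep, mul_zero, sub_zero]
    have h12 := hinj (e1.trans e2.symm)
    intro a
    exact congrFun h12 a
  -- the cone condition in abstract form
  have cone_iff : ∀ j, D j ≠ 0 →
      ((∀ a, 0 < D j * E j a) ↔ ∀ l, l ≠ j → 0 < a0 l - a0 j / lam j * lam l) := by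
    intro j hj
    have key : ∀ a, (0 < D j * E j a ↔
        0 < a0 (j.succAbove a) - a0 j / lam j * lam (j.succAbove a)) := by
      intro a
      rw [← coord j hj a]
      have hsq : 0 < D j * D j := mul_self_pos.mpr hj
      rw [show E j a / D j = D j * E j a / (D j * D j) from by field_simp]
      exact (div_pos_iff_of_pos_right hsq).symm
    constructor
    · intro h l hl
      obtain ⟨a, rfl⟩ := Fin.exists_succAbove_eq hl
      exact (key a).1 (h a)
    · intro h a
      exact (key a).2 (h _ (Fin.succAbove_ne j a))
  -- genericity in abstract form
  have hgen : ∀ j l, j ≠ l → lam j ≠ 0 → lam l ≠ 0 → a0 l - a0 j / lam j * lam l ≠ 0 := by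
    intro j l hjl hlj hll
    have hDj : D j ≠ 0 := (hlam_ne j).1 hlj
    have hDl : D l ≠ 0 := (hlam_ne l).1 hll
    obtain ⟨a, rfl⟩ := Fin.exists_succAbove_eq (Ne.symm hjl)
    rw [← coord j hDj a]
    exact div_ne_zero (H3 j a hDj hDl) hDj
  -- conclude with the abstract lemma
  have habs := circuit_abstract lam a0 ⟨jp, hjp⟩ H2 hgen
  have hsum : ∑ j : Fin 5, (-1 : ℝ) ^ (j : ℕ) * Real.sign (D j) *
        (if ∀ a, 0 < D j * E j a then (1 : ℝ) else 0)
      = ∑ j, Real.sign (lam j) *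
        (if (∀ l, l ≠ j → 0 < a0 l - a0 j / lam j * lam l) then (1 : ℝ) else 0) := by
    refine Finset.sum_congr rfl fun j _ => ?_
    by_cases hj : D j = 0
    · have hl : lam j = 0 := by simp [hlam, hj]
      simp [hj, hl, Real.sign_zero]
    · rw [if_congr (cone_iff j hj) rfl rfl]
      congr 1
      rw [show lam j = (-1 : ℝ) ^ (j : ℕ) * D j from rfl]
      rcases neg_one_pow_eq_or ℝ (j : ℕ) with h | h
      · rw [h, one_mul, one_mul]
      · rw [h, neg_one_mul, neg_one_mul, Real.sign_neg]
  rw [hsum]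
  exact habs

end Summit.KontsevichZagierPeriods.HyperbolicBloch.FiveTerm.Drefute
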